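/- Width seat `ym-line-cbag-p1-w2` (prover-ym-line-cbag-p1-w2-g14-0) on the planner-of-record's LINE 5, route `HankelDensitySplitting`:
helper for REGISTERED STUB B `stub_freeKernelMargin` of the birth skeleton v2 of crux `LogWindowMixedDominance` (stmt-QuantumFields-26617).
Pure lattice-Maxwell / lattice-Green-function analysis; RECORD-type material (node `LatticeNonFreezing`); the Yang–Mills mass gap is NOT
proved by anything here, and the crux stays open. -/
import Summits.QuantumFields.YangMills.Theorems.EquipartitionCriticalityEquipartitionPinsProbeAxisFourier
import Summits.QuantumFields.YangMills.Theorems.EquipartitionCriticalityEquipartitionPinsProbePoissonIntegral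
import Literature.Probability.LatticeModels.LatticeGreenPoisson
import HarnessLib

/-!
# The mixed (time / spatial-momentum) representation of the lattice Green function of `ℤ⁴`

Support file for crux `LogWindowMixedDominance` (stmt-QuantumFields-26617) of route `HankelDensitySplitting`, stub B
`FreeKernelMargin` (the pure lattice-Maxwell `n⁻⁸` margin).  Route-independent content (no `Theses` import):

* `GreenRepr.inner_integral` — for `ε > 0`, `n : ℤ` and a phase `φ`,
  `∫_{[-π,π]} cos(t n + φ)/((1 - cos t) + ε) dt = cos φ · 2π r(ε)^{|n|}/√(ε(ε+2))`, `r(ε) = 1 + ε − √(ε(ε+2))`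
  (the Poisson-kernel integral `EquipartitionPinsProbe.stub_poissonIntegral` for the cosine part; the sine part is odd);
* `GreenRepr.latticeGreen_cons_eq` — **the transfer-matrix (Källén–Lehmann) representation at a general site**: for `n : ℤ` and
  `x : Fin 3 → ℤ`,
  `latticeGreen (n, x) = (2π)⁻³ ∫_{[-π,π]³} cos(k·x) · r(ε₃(k))^{|n|}/√(ε₃(k)(ε₃(k)+2)) dk`, `ε₃ = dispersion` on `Fin 3 → ℝ`
  (Fubini over `[-π,π]⁴ = [-π,π] × [-π,π]³` exactly as the tree's `EquipartitionPinsProbe.AxisFourier.core`, which is the special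
  case of the axis second difference), together with the integrability of the `k`-integrand on `[-π,π]³`
  (`GreenRepr.integrableOn_mixedIntegrand`).

This is the standard spectral representation of the `d = 4` lattice Green function in one lattice direction (e.g. Lawler–Limic 2010
§4.3; Montvay–Münster 1994 §2); [folklore].  No rung or summit statement is proved here.
-/

set_option autoImplicit false

noncomputable section

namespace Summit.QuantumFields.YangMills.Theorems.HankelDensitySplitting.LogWindow

namespace GreenRepr

open Real MeasureTheory Set Literature.Probability.LatticeModels
open Summit.QuantumFields.YangMills.Theorems.EquipartitionPinsProbe (stub_poissonIntegral)
open Summit.QuantumFields.YangMills.Theorems.EquipartitionPinsProbe.AxisFourier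
  (split_symm_apply dispersion_cons split_symm_preimage_brillouin denom_pos cos_mul_intCast)

/-! ### The one-dimensional (time-momentum) integrals -/

/-- The sine part is odd, hence integrates to zero over `[-π,π]`: `∫_{-π}^{π} sin(t n)/((1 - cos t) + ε) dt = 0`. [folklore] -/
theorem integral_sin_div_eq_zero (ε : ℝ) (n : ℤ) :
    ∫ t in (-π)..π, Real.sin (t * n) / (1 - Real.cos t + ε) = 0 := by
  set f : ℝ → ℝ := fun t => Real.sin (t * n) / (1 - Real.cos t + ε) with hf
  have hodd : ∀ t, f (-t) = -f t := fun t => by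
    simp only [hf, neg_mul, Real.sin_neg, Real.cos_neg, neg_div]
  have h1 : ∫ t in (-π)..π, f (-t) = ∫ t in (-π)..π, f t := by
    rw [intervalIntegral.integral_comp_neg, neg_neg]
  have h2 : ∫ t in (-π)..π, f (-t) = -∫ t in (-π)..π, f t := by
    rw [← intervalIntegral.integral_neg]
    exact intervalIntegral.integral_congr fun t _ => hodd t
  have h3 : ∫ t in (-π)..π, f t = 0 := by linarith
  simpa only [hf] using h3

/-- **The time-momentum integral with a phase.**  For `ε > 0`, `n : ℤ` and `φ : ℝ`:
`∫_{[-π,π]} cos(t n + φ)/((1 - cos t) + ε) dt = cos φ · (2π · r^{|n|}/√(ε(ε+2)))`, `r = 1 + ε − √(ε(ε+2))`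
(Poisson-kernel integral for the cosine part, oddness for the sine part; `(1+ε)² − 1 = ε(ε+2)`). [folklore] -/
theorem inner_integral {ε : ℝ} (hε : 0 < ε) (n : ℤ) (φ : ℝ) :
    ∫ t in Icc (-π) π, Real.cos (t * n + φ) / (1 - Real.cos t + ε) =
      Real.cos φ * (2 * π * (1 + ε - Real.sqrt (ε * (ε + 2))) ^ n.natAbs / Real.sqrt (ε * (ε + 2))) := by
  have hππ : -π ≤ π := by linarith [Real.pi_pos]
  rw [integral_Icc_eq_integral_Ioc, ← intervalIntegral.integral_of_le hππ]
  have hfun : (fun t => Real.cos (t * n + φ) / (1 - Real.cos t + ε)) =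
      fun t => Real.cos φ * (Real.cos (n.natAbs * t) / (1 + ε - Real.cos t)) -
        Real.sin φ * (Real.sin (t * n) / (1 - Real.cos t + ε)) := by
    funext t
    rw [Real.cos_add, cos_mul_intCast, show 1 + ε - Real.cos t = 1 - Real.cos t + ε by ring]
    ring
  have hden : ∀ t, 1 - Real.cos t + ε ≠ 0 := fun t => (denom_pos hε t).ne'
  have hden' : ∀ t, 1 + ε - Real.cos t ≠ 0 := fun t => by
    rw [show 1 + ε - Real.cos t = 1 - Real.cos t + ε by ring]
    exact hden t
  have hc1 : Continuous fun t : ℝ => Real.cos (n.natAbs * t) / (1 + ε - Real.cos t) :=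
    Continuous.div (by fun_prop) (by fun_prop) hden'
  have hc2 : Continuous fun t : ℝ => Real.sin (t * n) / (1 - Real.cos t + ε) :=
    Continuous.div (by fun_prop) (by fun_prop) hden
  have hf : IntervalIntegrable (fun t : ℝ => Real.cos φ * (Real.cos (n.natAbs * t) / (1 + ε - Real.cos t)))
      volume (-π) π := (hc1.intervalIntegrable _ _).const_mul _
  have hg : IntervalIntegrable (fun t : ℝ => Real.sin φ * (Real.sin (t * n) / (1 - Real.cos t + ε)))
      volume (-π) π := (hc2.intervalIntegrable _ _).const_mul _
  rw [hfun, intervalIntegral.integral_sub hf hg, intervalIntegral.integral_const_mul,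
    intervalIntegral.integral_const_mul, integral_sin_div_eq_zero ε n, mul_zero, sub_zero,
    stub_poissonIntegral (1 + ε) (by linarith) n.natAbs, show (1 + ε) ^ 2 - 1 = ε * (ε + 2) by ring]

/-! ### Splitting off the time momentum -/

/-- The phase of a general site splits: `p · (n, x) = p₀ n + k · x` for `p = (p₀, k)`. -/
theorem phase_cons (n : ℤ) (x : Fin 3 → ℤ) (t : ℝ) (k : Fin 3 → ℝ) :
    ∑ i : Fin 4, (Fin.cons t k : Fin 4 → ℝ) i * (((Fin.cons n x : Fin 4 → ℤ) i : ℤ) : ℝ) =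
      t * n + ∑ i : Fin 3, k i * (x i : ℝ) := by
  simp only [Fin.sum_univ_succ (n := 3), Fin.cons_zero, Fin.cons_succ]

/-- The Green integrand at a general site in split coordinates. -/
theorem greenIntegrand_cons (n : ℤ) (x : Fin 3 → ℤ) (t : ℝ) (k : Fin 3 → ℝ) :
    greenIntegrand (Fin.cons n x : Site 4) (Fin.cons t k) =
      Real.cos (t * n + ∑ i : Fin 3, k i * (x i : ℝ)) / (1 - Real.cos t + dispersion k) := by
  rw [greenIntegrand, dispersion_cons, phase_cons]

/-- Integrability of the split Green integrand on `[-π,π] × [-π,π]³` (transport of the tree's `integrableOn_greenIntegrand`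
along the volume-preserving splitting `ℝ⁴ ≃ᵐ ℝ × ℝ³`). -/
theorem integrableOn_split (n : ℤ) (x : Fin 3 → ℤ) :
    IntegrableOn (fun y : ℝ × (Fin 3 → ℝ) =>
        Real.cos (y.1 * n + ∑ i : Fin 3, y.2 i * (x i : ℝ)) / (1 - Real.cos y.1 + dispersion y.2))
      (Icc (-π) π ×ˢ brillouin 3) ((volume : Measure ℝ).prod (volume : Measure (Fin 3 → ℝ))) := by
  have he : MeasurePreserving (MeasurableEquiv.piFinSuccAbove (fun _ : Fin 4 => ℝ) 0)
      (volume : Measure (Fin 4 → ℝ)) ((volume : Measure ℝ).prod (volume : Measure (Fin 3 → ℝ))) :=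
    volume_preserving_piFinSuccAbove (fun _ : Fin 4 => ℝ) 0
  have h := (he.symm.integrableOn_comp_preimage
    (MeasurableEquiv.piFinSuccAbove (fun _ : Fin 4 => ℝ) 0).symm.measurableEmbedding).2
    (integrableOn_greenIntegrand 4 (by norm_num) (Fin.cons n x : Site 4))
  rw [split_symm_preimage_brillouin] at h
  refine h.congr_fun ?_ (measurableSet_Icc.prod (measurableSet_brillouin 3))
  rintro ⟨t, k⟩ -
  simp only [Function.comp_apply, split_symm_apply, greenIntegrand_cons]

/-- **The mixed representation of the lattice Green function of `ℤ⁴` at a general site** (before normalisation):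
`∫_{[-π,π]⁴} cos(p·(n,x))/ε(p) dp = 2π ∫_{[-π,π]³} cos(k·x) · r(ε₃(k))^{|n|}/√(ε₃(k)(ε₃(k)+2)) dk`. [folklore] -/
theorem core (n : ℤ) (x : Fin 3 → ℤ) :
    ∫ p in brillouin 4, greenIntegrand (Fin.cons n x : Site 4) p =
      2 * π * ∫ k in brillouin 3, Real.cos (∑ i : Fin 3, k i * (x i : ℝ)) *
        ((1 + dispersion k - Real.sqrt (dispersion k * (dispersion k + 2))) ^ n.natAbs /
          Real.sqrt (dispersion k * (dispersion k + 2))) := by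
  have he : MeasurePreserving (MeasurableEquiv.piFinSuccAbove (fun _ : Fin 4 => ℝ) 0)
      (volume : Measure (Fin 4 → ℝ)) ((volume : Measure ℝ).prod (volume : Measure (Fin 3 → ℝ))) :=
    volume_preserving_piFinSuccAbove (fun _ : Fin 4 => ℝ) 0
  calc ∫ p in brillouin 4, greenIntegrand (Fin.cons n x : Site 4) p
      = ∫ y in (MeasurableEquiv.piFinSuccAbove (fun _ : Fin 4 => ℝ) 0).symm ⁻¹' brillouin 4,
          greenIntegrand (Fin.cons n x : Site 4) ((MeasurableEquiv.piFinSuccAbove (fun _ : Fin 4 => ℝ) 0).symm y)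
          ∂((volume : Measure ℝ).prod (volume : Measure (Fin 3 → ℝ))) :=
        (he.symm.setIntegral_preimage_emb
          (MeasurableEquiv.piFinSuccAbove (fun _ : Fin 4 => ℝ) 0).symm.measurableEmbedding
          (greenIntegrand (Fin.cons n x : Site 4)) (brillouin 4)).symm
    _ = ∫ y in Icc (-π) π ×ˢ brillouin 3,
          Real.cos (y.1 * n + ∑ i : Fin 3, y.2 i * (x i : ℝ)) / (1 - Real.cos y.1 + dispersion y.2)
          ∂((volume : Measure ℝ).prod (volume : Measure (Fin 3 → ℝ))) := by
        rw [split_symm_preimage_brillouin]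
        refine setIntegral_congr_fun (measurableSet_Icc.prod (measurableSet_brillouin 3)) ?_
        rintro ⟨t, k⟩ -
        simp only [split_symm_apply, greenIntegrand_cons]
    _ = ∫ k in brillouin 3, ∫ t in Icc (-π) π,
          Real.cos (t * n + ∑ i : Fin 3, k i * (x i : ℝ)) / (1 - Real.cos t + dispersion k) := by
        have hint := integrableOn_split n x
        simp only [IntegrableOn, ← Measure.prod_restrict] at hint ⊢
        exact integral_prod_symm _ hint
    _ = ∫ k in brillouin 3, 2 * π * (Real.cos (∑ i : Fin 3, k i * (x i : ℝ)) *
          ((1 + dispersion k - Real.sqrt (dispersion k * (dispersion k + 2))) ^ n.natAbs /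
            Real.sqrt (dispersion k * (dispersion k + 2)))) := by
        refine integral_congr_ae ?_
        filter_upwards [ae_restrict_of_ae (s := brillouin 3) (ae_ne_zero_volume_pi (d := 3)
          (by norm_num)), ae_restrict_mem (measurableSet_brillouin 3)] with k hk0 hkB
        rw [inner_integral (dispersion_pos_of_mem_brillouin hkB hk0)]
        ring
    _ = 2 * π * ∫ k in brillouin 3, Real.cos (∑ i : Fin 3, k i * (x i : ℝ)) *
          ((1 + dispersion k - Real.sqrt (dispersion k * (dispersion k + 2))) ^ n.natAbs /
            Real.sqrt (dispersion k * (dispersion k + 2))) :=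
        integral_const_mul _ _

/-- **The mixed (transfer-matrix) representation of the `d = 4` lattice Green function at a general site.**  For `n : ℤ` and
`x : Fin 3 → ℤ`,
`latticeGreen (n, x) = (2π)⁻³ ∫_{[-π,π]³} cos(k·x) · r(ε₃(k))^{|n|}/√(ε₃(k)(ε₃(k)+2)) dk`, `r(ε) = 1 + ε − √(ε(ε+2)) = e^{−ω}`,
`cosh ω = 1 + ε₃(k)`. [folklore] -/
theorem latticeGreen_cons_eq (n : ℤ) (x : Fin 3 → ℤ) :
    latticeGreen (Fin.cons n x : Site 4) =
      (∫ k in brillouin 3, Real.cos (∑ i : Fin 3, k i * (x i : ℝ)) *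
        ((1 + dispersion k - Real.sqrt (dispersion k * (dispersion k + 2))) ^ n.natAbs /
          Real.sqrt (dispersion k * (dispersion k + 2)))) / (2 * π) ^ 3 := by
  rw [latticeGreen_eq, core]
  have hπ : Real.pi ≠ 0 := Real.pi_ne_zero
  field_simp
  ring

/-- The inner time integral, as a function of the spatial momentum, is integrable on `[-π,π]³` (Fubini). -/
theorem integrableOn_inner (n : ℤ) (x : Fin 3 → ℤ) :
    IntegrableOn (fun k : Fin 3 → ℝ => ∫ t in Icc (-π) π,
        Real.cos (t * n + ∑ i : Fin 3, k i * (x i : ℝ)) / (1 - Real.cos t + dispersion k)) (brillouin 3) := by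
  have hint := integrableOn_split n x
  simp only [IntegrableOn, ← Measure.prod_restrict] at hint
  exact hint.integral_prod_right

/-- **Integrability of the mixed integrand** `cos(k·x) · r(ε₃(k))^{|n|}/√(ε₃(k)(ε₃(k)+2))` on `[-π,π]³` (it is a.e. `(2π)⁻¹` times the
inner time integral of the integrable split Green integrand). [folklore] -/
theorem integrableOn_mixedIntegrand (n : ℤ) (x : Fin 3 → ℤ) :
    IntegrableOn (fun k : Fin 3 → ℝ => Real.cos (∑ i : Fin 3, k i * (x i : ℝ)) *
        ((1 + dispersion k - Real.sqrt (dispersion k * (dispersion k + 2))) ^ n.natAbs /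
          Real.sqrt (dispersion k * (dispersion k + 2)))) (brillouin 3) := by
  have h1 : IntegrableOn (fun k : Fin 3 → ℝ => 2 * π * (Real.cos (∑ i : Fin 3, k i * (x i : ℝ)) *
        ((1 + dispersion k - Real.sqrt (dispersion k * (dispersion k + 2))) ^ n.natAbs /
          Real.sqrt (dispersion k * (dispersion k + 2))))) (brillouin 3) := by
    refine (integrableOn_inner n x).congr_fun_ae ?_
    filter_upwards [ae_restrict_of_ae (s := brillouin 3) (ae_ne_zero_volume_pi (d := 3)
      (by norm_num)), ae_restrict_mem (measurableSet_brillouin 3)] with k hk0 hkB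
    rw [inner_integral (dispersion_pos_of_mem_brillouin hkB hk0)]
    ring
  have h2 : IntegrableOn (fun k : Fin 3 → ℝ => 1 / (2 * π) * (2 * π * (Real.cos (∑ i : Fin 3, k i * (x i : ℝ)) *
        ((1 + dispersion k - Real.sqrt (dispersion k * (dispersion k + 2))) ^ n.natAbs /
          Real.sqrt (dispersion k * (dispersion k + 2)))))) (brillouin 3) := h1.const_mul _
  refine IntegrableOn.congr_fun h2 ?_ (measurableSet_brillouin 3)
  intro k _
  have hπ : Real.pi ≠ 0 := Real.pi_ne_zero
  field_simp

end GreenRepr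

end Summit.QuantumFields.YangMills.Theorems.HankelDensitySplitting.LogWindow

end
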